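import Literature.IUT.HodgeArakelov.MonoThetaProjectiveModelSystem
import Literature.IUT.HodgeArakelov.EtaleThetaDataOfSettingCor218i

/-!
# Bridge B8, part 5d: the `θ_env` data ([IUTchII] Prop. 1.5 (iii)) of the NATURAL projective system of model
# mono-theta environments of `X̲̲_K`, modulo the limit cyclotomic rigidity `(l·Δ_Θ) ≅ lim_M μ_M`

abc-iut cell, MERGE-MAP §8 **B8** (layer L6 ↔ L2), continuation of part 5c (`MonoThetaProjectiveModelSystem`:
`EtaleLevels.modelSystem`, the natural projective system `… → 𝕄_{M'} → 𝕄_M → …` over ALL `M ∈ ℕ_{≥1}`), of abc-iut-L6-d6's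
part 5b/6 (`ModelFrame.cyclotomicRigidity`: the [IUTchII] Def. 1.1 (ii) cyclotomic rigidity isomorphism of the [EtTh]
model) and of abc-iut-L6-t1 g2 / w4-d013's `EtaleThetaDataOfSetting` (the [IUTchII] Prop. 1.4 output `EtaleThetaData`
at the genuine group `Π^tp_{X̲̲}`, REAL continuous cohomology); seat abc-iut-w4-d030; DAG node **IUTchII:Prop1.5(iii)**
(and, with part 5c, abc-iut-L6-t1's predicate `Prop15_ii_iii` = nodes (ii)+(iii)). S. Mochizuki, *Inter-universal
Teichmüller theory II*, kurims manuscript (Dec. 2020), Prop. 1.5 (iii) pp. 29–30: "a projective limit exterior cyclotome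
`Π_μ(M^Θ_*)` which is equipped with a uniquely determined cyclotomic rigidity isomorphism `(l·Δ_Θ)(M^Θ_*) ⥲ Π_μ(M^Θ_*)` [i.e., obtained by applying the
cyclotomic rigidity isomorphisms of Definition 1.1, (ii), to the various members of the projective system `M^Θ_*`]"
[claim: Mochizuki2012, status: disputed] (IUTchII §1 Prop 1.5 (iii), kurims pp.29-30); [EtTh] §1 p. 12 (`Δ_Θ ≅ Ẑ(1)`, PRIMS
p. 238) [cite: MochizukiEtTh2009, Cor 2.19(i) p.64].

* `EtaleLevels.etaleData` — the Prop. 1.4 output at `Π_X(𝕄_*) = Π^tp_{X̲̲}` (= `etaleThetaDataOfSetting'` at the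
  [IUTchII] setting of part 5 with the identity identification; input BY NAME: `PiYddCharacteristic C`, the
  `Π^tp_{Ÿ}`-clause of [EtTh] Cor. 2.18 (i) at `X̲̲`, FACT-LIST class of `RigidData.Cor218_i`);
* `EtaleLevels.rigid M` — the mod-`M` cyclotomic rigidity isomorphism of the model (part 5b/6, at the identity frame);
* `EtaleLevels.intCompat M` — `(l·Δ_Θ)(𝕄_*) = (l·Δ_Θ)/thetaKer → (l·Δ_Θ)(𝕄_M) ⊗ ℤ/Mℤ` (the interior cyclotome of EVERY
  level is the SAME subquotient of `Π^tp_{Y̲̲}`, part 5b; the map is reduction mod `M`);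
* `EtaleLevels.rigidLimHom` — **the limit cyclotomic rigidity map** `(l·Δ_Θ)(𝕄_*) → Π_μ(𝕄_*)`,
  `a ↦ ((rigid M)(intCompat M a))_M`, PROVED to land in the projective-limit exterior cyclotome `Sys.extCycLim`
  (each component in `Π_μ(𝕄_M)`; compatibility with `red_{M',M}` = the compatibility `hmods` of the identifications
  `μ_M ≅ (l·Δ_Θ) ⊗ ℤ/Mℤ`); `coe_rigid_iso_intCompat_mk`: its `M`-component on the class of `g ∈ l·Δ_Θ` is
  `μ_M ∋ (g mod M) ↪ Π^tp_{Y̲̲}[μ_M]` ON THE NOSE;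
* `EtaleLevels.thetaEnvData (hlim)` — **the `θ_env` data of Prop. 1.5 (iii) for the natural system**
  (`ThetaEnvData modelSystem`): `D :=` the Prop. 1.4 output, `rigid`, `rigidLim := rigidLimHom` made an isomorphism by
  the ONE explicit hypothesis `hlim : Function.Bijective rigidLimHom` — i.e. `(l·Δ_Θ) ⥲ lim_M μ_M`, the level-wise
  content of `Δ_Θ ≅ Ẑ(1)` ([EtTh] §1 p. 12) that the L2 interface does not record (`M`-adic separatedness and
  completeness of `l·Δ_Θ`; cf. part 6's residual `hZ : (l·Δ_Θ)/thetaKer ≅ Ẑ`), `rigidLim_compat` by `rfl`, and the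
  cohomology with coefficients `Π_μ(𝕄_*)` REALISED as the Prop. 1.4 cohomology system itself with the coefficients
  identified through `rigidLim` (identity transport — the typed interface `CohomologySystem` carries no coefficient
  functoriality, so "by transporting `θ(Π)` via the above cyclotomic rigidity isomorphism" (p. 30) is the identity on
  the carrier);
* `EtaleLevels.prop15_ii_iii_modelSystem` — abc-iut-L6-t1's **`Prop15_ii_iii (modelSystem …)`** = [IUTchII] Prop. 1.5
  (ii)+(iii) at the genuine instance, modulo BY NAME: `IsTopCharacteristic` of `Π^tp_{Y̲̲}` ([EtTh] Prop. 2.4 content),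
  `ThetaEnvData.Cor218_iv_surjective` (F-0639), `PiYddCharacteristic C` (Cor. 2.18 (i) `Ÿ`-clause) and `hlim`;
  `EtaleLevels.prop15_ii_iii_modelSystem_of_cor218_i` — the same with both topological inputs derived from the [EtTh]
  Cor. 2.18 (i) named fact `RigidData.Cor218_i` (abc-iut-w4-d013's `EtaleThetaDataOfSettingCor218i`), i.e. modulo
  {`RigidData.Cor218_i`, `ThetaEnvData.Cor218_iv_surjective`, `hlim`} BY NAME.
HONEST FRAMING: constructions over the cell's own [EtTh]-side objects; nothing disputed is asserted ([IUTchII] claim key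
`Mochizuki2012`, DISPUTED); no side is taken on [IUTchIII] Cor. 3.12; typed ≠ discharged.
-/

noncomputable section

namespace Literature.IUT.HodgeArakelov

open Literature.AnabelianGeometry.EtaleTheta Literature.AnabelianGeometry.SemiGraphs
open scoped Literature.AnabelianGeometry.EtaleTheta

namespace EtaleLevels

variable {p : ℕ} [Fact p.Prime] {D : Literature.AnabelianGeometry.EtaleTheta.ThetaSetting p}
  {E : D.EtaleThetaData} {l : ℕ} (C : E.DoubleUnderline l) (hC : D.Compat) (hS : D.Sec2Hyps)
  (hl : l.Prime) (hp2 : p ≠ 2) (hpl : p ≠ l) (hζ : ∃ ζ : D.K, IsPrimitiveRoot ζ (4 * l))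
  (mods : ∀ M : ℕ+, D.CyclotomeMod l M)
  (f : contCocycles D.toTheta D.DeltaTheta C.GtpYdduu) (hf : f ∈ C.rootCocycles hC)
  (hmods : ∀ (M M' : ℕ+) (h : (M : ℕ) ∣ (M' : ℕ)) (x : D.lDeltaTheta l),
    MuN.red p M M' h ((mods M').red x) = (mods M).red x)
  (h15 : Literature.AnabelianGeometry.EtaleTheta.ThetaSetting.Prop15iii E hC) (L : C.CuspLabels)
  (hZ : ∀ M : ℕ+, Nonempty (ModelCyclotomes.lDeltaQuot (C.rigidData (mods M) hC hS h15 L) ≃*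
    Literature.IUT.HodgeTheaters.ZHat))
  (hcharY : EtaleThetaDataOfSetting.PiYddCharacteristic C)

/-! ## The Prop. 1.4 output at `Π_X(𝕄_*) = Π^tp_{X̲̲}` -/

/-- **The [IUTchII] Prop. 1.4 output `(Π_Ÿ(Π), (l·Δ_Θ)(Π), θ(Π))` at `Π = Π_X(𝕄_*) = Π^tp_{X̲̲}`** (abc-iut-L6-t1 g2 /
w4-d013's `etaleThetaDataOfSetting'` at the [IUTchII] setting of part 5, identity identification; input: the
`Π^tp_{Ÿ}`-clause of [EtTh] Cor. 2.18 (i), `PiYddCharacteristic C`). [claim: Mochizuki2012, status: disputed] (IUTchII §1 Prop 1.4, kurims p.27) -/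
def etaleData : EtaleThetaData (setting C hC hS hl hp2 hpl hζ mods f hf)
    (modelSystem C hC hS hl hp2 hpl hζ mods f hf hmods h15 L hZ).PiX :=
  etaleThetaDataOfSetting' C hC hS hcharY (setting C hC hS hl hp2 hpl hζ mods f hf) (ContinuousMulEquiv.refl _) rfl

/-! ## The mod-`M` cyclotomic rigidity isomorphisms and the limit rigidity map -/

/-- The underlying map of abc-iut-L6-d6's model cyclotomic rigidity isomorphism (dot-notation extension of
`ModelFrame`, stated here for use below; it is `rfl` by part 5b's `coe_extEquiv`): `c ↦ e⁻¹(μ_N ∋ intModEquiv c)`.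
[claim: Mochizuki2012, status: disputed] (IUTchII §1 Def 1.1 (ii), kurims p.21) -/
theorem _root_.Literature.IUT.HodgeArakelov.ModelFrame.coe_cyclotomicRigidity_iso_apply
    {S : ThetaSetting.{0}} {l' : ℕ} {R : RigidData.{0} S.N l'} (F : ModelFrame S R) {M : MonoThetaEnv S}
    (e : M.Pi ≃ₜ* R.env) (c : ModPow (ModelCyclotomes.intCyc R).carrier (S.N : ℕ)) :
    ((F.cyclotomicRigidity e).iso c : M.Pi) = e.symm (CycEnvelope.inMu R.augY R.chi (ModelCyclotomes.intModEquiv R c)) :=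
  rfl

/-- **The mod-`M` cyclotomic rigidity isomorphism `(l·Δ_Θ)(𝕄_M) ⊗ ℤ/Mℤ ⥲ Π_μ(𝕄_M)` of the MODEL** ([IUTchII] Def. 1.1 (ii);
abc-iut-L6-d6's `ModelFrame.cyclotomicRigidity` at the identity frame). [claim: Mochizuki2012, status: disputed] (IUTchII §1 Def 1.1 (ii), kurims p.21) -/
def rigid (M : ℕ+) : CyclotomicRigidity (modelRecon C hC hS hl hp2 hpl hζ mods f hf h15 L hZ M) :=
  (modelFrame C hC hS hl hp2 hpl hζ mods f hf h15 L hZ M).cyclotomicRigidity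
    (M := (modelFamily C hC hS hl hp2 hpl hζ mods f hf).modelEnv M) (ContinuousMulEquiv.refl _)

/-- **`(l·Δ_Θ)(𝕄_*) → (l·Δ_Θ)(𝕄_M) ⊗ ℤ/Mℤ`**: the interior cyclotome of every member of the natural system is the SAME
subquotient `(l·Δ_Θ)/thetaKer` of `Π^tp_{Y̲̲}` (part 5b `ModelCyclotomes.intCyc`, `intCycEquiv`), and `(l·Δ_Θ)(𝕄_*)`
(the subquotient `φ⁻¹(l·Δ_Θ)/Ker φ` of `Π^tp_{X̲̲}` of the Prop. 1.4 output) is that quotient; the map is reduction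
modulo `M`-th powers. [claim: Mochizuki2012, status: disputed] (IUTchII §1 Prop 1.5 (iii), kurims p.29) -/
def intCompat (M : ℕ+) :
    (EtaleThetaDataOfSetting.lDeltaSubquotient C).carrier →*
      ModPow (ModelCyclotomes.intCyc (C.rigidData (mods M) hC hS h15 L)).carrier (M : ℕ) :=
  (QuotientGroup.mk' _).comp
    (ModelCyclotomes.intCycEquiv (C.rigidData (mods M) hC hS h15 L)).symm.toMonoidHom

/-- The value of the mod-`M` rigidity isomorphism of the model: `c ↦ (μ_M ∋ intModEquiv c) ↪ Π^tp_{Y̲̲}[μ_M]`.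
[claim: Mochizuki2012, status: disputed] (IUTchII §1 Def 1.1 (ii), kurims p.21) -/
theorem coe_rigid_iso (M : ℕ+) (c : ModPow (ModelCyclotomes.intCyc (C.rigidData (mods M) hC hS h15 L)).carrier (M : ℕ)) :
    ((rigid C hC hS hl hp2 hpl hζ mods f hf h15 L hZ M).iso c).val =
      (CycEnvelope.inMu (levelData C hC hS mods M).augY (levelData C hC hS mods M).chi
        (ModelCyclotomes.intModEquiv (C.rigidData (mods M) hC hS h15 L) c) : (levelData C hC hS mods M).env) :=
  ModelFrame.coe_cyclotomicRigidity_iso_apply (modelFrame C hC hS hl hp2 hpl hζ mods f hf h15 L hZ M)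
    (M := (modelFamily C hC hS hl hp2 hpl hζ mods f hf).modelEnv M) (ContinuousMulEquiv.refl _) c

/-- The `M`-component of the limit rigidity map ON THE NOSE: on the class of `g ∈ φ⁻¹(l·Δ_Θ) ⊆ Π^tp_{X̲̲}` it is
`μ_M ∋ (φ(g) mod M) ↪ Π^tp_{Y̲̲}[μ_M]` (the identification `μ_M ≅ (l·Δ_Θ) ⊗ ℤ/Mℤ` of level `M` followed by the inclusion
of the cyclotome). [claim: Mochizuki2012, status: disputed] (IUTchII §1 Prop 1.5 (iii), kurims p.29) -/
theorem coe_rigid_iso_intCompat_mk (M : ℕ+) (g : ↥(EtaleThetaDataOfSetting.lDeltaSubquotient C).top) :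
    ((rigid C hC hS hl hp2 hpl hζ mods f hf h15 L hZ M).iso
        (intCompat C hC hS mods h15 L M (QuotientGroup.mk g))).val =
      (CycEnvelope.inMu (levelData C hC hS mods M).augY (levelData C hC hS mods M).chi
        ((mods M).red (C.toLDelta g)) : (levelData C hC hS mods M).env) := by
  rw [coe_rigid_iso]
  have h1 : ModelCyclotomes.intModEquiv (C.rigidData (mods M) hC hS h15 L)
      (intCompat C hC hS mods h15 L M (QuotientGroup.mk g)) =
      (mods M).red (C.toLDelta g) := by
    change ModelCyclotomes.intModEquiv (C.rigidData (mods M) hC hS h15 L)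
        (QuotientGroup.mk ((ModelCyclotomes.intCycEquiv (C.rigidData (mods M) hC hS h15 L)).symm
          (QuotientGroup.mk g))) = _
    rw [ModelCyclotomes.intModEquiv, MulEquiv.trans_apply, ModelCyclotomes.modPowCongr_mk,
      MulEquiv.apply_symm_apply]
    exact ModelCyclotomes.lDeltaModEquiv_mk_mk (C.rigidData (mods M) hC hS h15 L) g
  rw [h1]

include hmods in
/-- **The components are compatible with the model reductions**: `red_{M',M}` carries the `M'`-component to the
`M`-component — this IS the compatibility `hmods` of the identifications `μ_M ≅ (l·Δ_Θ) ⊗ ℤ/Mℤ` ("obtained by applying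
the cyclotomic rigidity isomorphisms … to the various members of the projective system").
[claim: Mochizuki2012, status: disputed] (IUTchII §1 Prop 1.5 (iii), kurims p.29) -/
theorem red_rigid_iso_intCompat {M M' : ℕ+} (h : (M : ℕ) ∣ (M' : ℕ))
    (a : (EtaleThetaDataOfSetting.lDeltaSubquotient C).carrier) :
    red C hC hS mods h
        ((rigid C hC hS hl hp2 hpl hζ mods f hf h15 L hZ M').iso
          (intCompat C hC hS mods h15 L M' a)).val =
      ((rigid C hC hS hl hp2 hpl hζ mods f hf h15 L hZ M).iso
        (intCompat C hC hS mods h15 L M a)).val := by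
  induction a using QuotientGroup.induction_on with
  | H g =>
    rw [coe_rigid_iso_intCompat_mk, coe_rigid_iso_intCompat_mk, ← hmods M M' h (C.toLDelta g)]
    exact SemidirectProduct.map_inl _ _ _ _

/-- **The limit cyclotomic rigidity map `(l·Δ_Θ)(𝕄_*) → Π_μ(𝕄_*)`** ([IUTchII] Prop. 1.5 (iii): "obtained by applying
the cyclotomic rigidity isomorphisms of Definition 1.1, (ii), to the various members of the projective system"), as a
homomorphism INTO the projective-limit exterior cyclotome `Sys.extCycLim` of abc-iut-L6-t1 (every component lies in
`Π_μ(𝕄_M)`; compatibility by `red_rigid_iso_intCompat`). [claim: Mochizuki2012, status: disputed] (IUTchII §1 Prop 1.5 (iii), kurims p.29) -/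
def rigidLimHom :
    (EtaleThetaDataOfSetting.lDeltaSubquotient C).carrier →*
      (modelSystem C hC hS hl hp2 hpl hζ mods f hf hmods h15 L hZ).extCycLim :=
  (MonoidHom.pi fun M : ℕ+ =>
      ((modelRecon C hC hS hl hp2 hpl hζ mods f hf h15 L hZ M).extCyc.subtype.comp
        ((rigid C hC hS hl hp2 hpl hζ mods f hf h15 L hZ M).iso.toMonoidHom.comp
          (intCompat C hC hS mods h15 L M)))).codRestrict _ fun a =>
    ⟨fun M => ((rigid C hC hS hl hp2 hpl hζ mods f hf h15 L hZ M).iso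
        (intCompat C hC hS mods h15 L M a)).2,
      fun _ _ h => red_rigid_iso_intCompat C hC hS hl hp2 hpl hζ mods f hf hmods h15 L hZ h a⟩

/-- The `M`-component of `rigidLimHom a` IS `(rigid M)(intCompat M a)` (bookkeeping, on the nose).
[claim: Mochizuki2012, status: disputed] (IUTchII §1 Prop 1.5 (iii), kurims p.29) -/
theorem rigidLimHom_apply_coe (a : (EtaleThetaDataOfSetting.lDeltaSubquotient C).carrier) (M : ℕ+) :
    ((rigidLimHom C hC hS hl hp2 hpl hζ mods f hf hmods h15 L hZ a : ∀ M',
        ((modelSystem C hC hS hl hp2 hpl hζ mods f hf hmods h15 L hZ).env M').Pi) M) =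
      ((rigid C hC hS hl hp2 hpl hζ mods f hf h15 L hZ M).iso
        (intCompat C hC hS mods h15 L M a)).val :=
  rfl

/-! ## The `θ_env` data of the natural system -/

/-- **The `θ_env` data of [IUTchII] Prop. 1.5 (iii) for the NATURAL projective system of `X̲̲_K`** (abc-iut-L6-t1's
`ThetaEnvData`): the Prop. 1.4 output at `Π^tp_{X̲̲}`; the mod-`M` cyclotomic rigidity isomorphisms of the models; the
limit cyclotomic rigidity isomorphism `(l·Δ_Θ)(𝕄_*) ⥲ Π_μ(𝕄_*)` = `rigidLimHom`, an isomorphism by the ONE explicit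
hypothesis `hlim` (`(l·Δ_Θ) ⥲ lim_M μ_M`, the level-wise content of `Δ_Θ ≅ Ẑ(1)`, [EtTh] §1 p. 12: `M`-adic
separatedness and completeness of `l·Δ_Θ`, not recorded by the L2 interface), compatible with the mod-`M` ones BY
`rfl`; and `H¹(Π_Ÿ(𝕄_*)|_J, Π_μ(𝕄_*))` realised as the Prop. 1.4 cohomology system with coefficients identified through
`rigidLim` (identity transport). [claim: Mochizuki2012, status: disputed] (IUTchII §1 Prop 1.5 (iii), kurims pp.29-30) -/
def thetaEnvData (hlim : Function.Bijective (rigidLimHom C hC hS hl hp2 hpl hζ mods f hf hmods h15 L hZ)) :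
    ThetaEnvData (modelSystem C hC hS hl hp2 hpl hζ mods f hf hmods h15 L hZ) where
  D := etaleData C hC hS hl hp2 hpl hζ mods f hf hmods h15 L hZ hcharY
  rigid := rigid C hC hS hl hp2 hpl hζ mods f hf h15 L hZ
  rigidLim := MulEquiv.ofBijective (rigidLimHom C hC hS hl hp2 hpl hζ mods f hf hmods h15 L hZ) hlim
  intCompat := intCompat C hC hS mods h15 L
  rigidLim_compat _ _ := rfl
  cohEnv := (etaleData C hC hS hl hp2 hpl hζ mods f hf hmods h15 L hZ hcharY).coh
  transportH1 _ := AddEquiv.refl _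
  transportLim := AddEquiv.refl _
  transport_compat _ _ := rfl

include hcharY in
/-- **Non-vacuity of `ThetaEnvData` at the natural system** (node IUTchII:Prop1.5(iii) as a construction), modulo
`PiYddCharacteristic C` and the limit rigidity `hlim`. [claim: Mochizuki2012, status: disputed] (IUTchII §1 Prop 1.5 (iii), kurims pp.29-30) -/
theorem nonempty_thetaEnvData
    (hlim : Function.Bijective (rigidLimHom C hC hS hl hp2 hpl hζ mods f hf hmods h15 L hZ)) :
    Nonempty (ThetaEnvData (modelSystem C hC hS hl hp2 hpl hζ mods f hf hmods h15 L hZ)) :=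
  ⟨thetaEnvData C hC hS hl hp2 hpl hζ mods f hf hmods h15 L hZ hcharY hlim⟩

include hcharY in
/-- **[IUTchII] Prop. 1.5 (ii)+(iii) FOR THE NATURAL SYSTEM of `X̲̲_K`** — abc-iut-L6-t1's predicate
`Prop15_ii_iii (EtaleLevels.modelSystem …)` (the transitions-are-isomorphisms / lifting clause (ii) AND non-emptiness
of the `θ_env` data (iii)), PROVED modulo, BY NAME: topological characteristicity of
`Π^tp_{Y̲̲} ⊆ Π^tp_{X̲̲}` (`hchar`, [EtTh] Prop. 2.4 content), the level fact `ThetaEnvData.Cor218_iv_surjective`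
(`hsurj`, F-0639), the `Π^tp_{Ÿ}`-clause of [EtTh] Cor. 2.18 (i) (`hcharY`) and the limit rigidity `hlim`; data inputs
`Prop15iii`, `CuspLabels`, `hZ` as in part 5c. [claim: Mochizuki2012, status: disputed] (IUTchII §1 Prop 1.5 (ii)(iii), kurims pp.29-30) -/
theorem prop15_ii_iii_modelSystem
    (hchar : Literature.AnabelianGeometry.EtaleTheta.IsTopCharacteristic ↥C.Huu (D.GtpY.subgroupOf C.Huu))
    (hsurj : ∀ M : ℕ+, (levelData C hC hS mods M).Cor218_iv_surjective)
    (hlim : Function.Bijective (rigidLimHom C hC hS hl hp2 hpl hζ mods f hf hmods h15 L hZ)) :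
    Literature.IUT.HodgeArakelov.Prop15_ii_iii (modelSystem C hC hS hl hp2 hpl hζ mods f hf hmods h15 L hZ) :=
  ⟨transitionsAreIsos_modelSystem C hC hS hl hp2 hpl hζ mods f hf hmods h15 L hZ hchar hsurj,
    nonempty_thetaEnvData C hC hS hl hp2 hpl hζ mods f hf hmods h15 L hZ hcharY hlim⟩

/-- **[IUTchII] Prop. 1.5 (ii)+(iii) for the natural system, NAMED-FACT form**: the two topological inputs `hchar`
(`Π^tp_{Y̲̲}` stable under every topological automorphism of `Π^tp_{X̲̲}`) and `hcharY` (`PiYddCharacteristic C`)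
both follow from abc-iut-L2-t2's [EtTh] Cor. 2.18 (i) named fact `RigidData.Cor218_i` at abc-iut-L2-t8's rigidity
data (abc-iut-w4-d013's `RigidData.map_PiY_eq_of_cor218_i`, `EtaleThetaDataOfSetting.piYddCharacteristic_of_cor218_i`);
so abc-iut-L6-t1's `Prop15_ii_iii (modelSystem …)` holds modulo, BY NAME, the level facts `RigidData.Cor218_i`
(F-0620 class), `ThetaEnvData.Cor218_iv_surjective` (F-0639) and the limit rigidity `hlim`.
[claim: Mochizuki2012, status: disputed] (IUTchII §1 Prop 1.5 (ii)(iii), kurims pp.29-30) -/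
theorem prop15_ii_iii_modelSystem_of_cor218_i
    (h218i : ∀ M : ℕ+, (C.rigidData (mods M) hC hS h15 L).Cor218_i)
    (hsurj : ∀ M : ℕ+, (levelData C hC hS mods M).Cor218_iv_surjective)
    (hlim : Function.Bijective (rigidLimHom C hC hS hl hp2 hpl hζ mods f hf hmods h15 L hZ)) :
    Literature.IUT.HodgeArakelov.Prop15_ii_iii (modelSystem C hC hS hl hp2 hpl hζ mods f hf hmods h15 L hZ) :=
  prop15_ii_iii_modelSystem C hC hS hl hp2 hpl hζ mods f hf hmods h15 L hZ
    (EtaleThetaDataOfSetting.piYddCharacteristic_of_cor218_i C (mods 1) hC hS h15 L _ rfl (h218i 1))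
    (fun γ => RigidData.map_PiY_eq_of_cor218_i _ (h218i 1) γ) hsurj hlim

end EtaleLevels

end Literature.IUT.HodgeArakelov
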